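import Summits.BirchSwinnertonDyer.BirchSwinnertonDyer.Theorems.ByReductionTypeAtTwoMultUpperHalfTowerSplitOneBit
import Summits.BirchSwinnertonDyer.BirchSwinnertonDyer.Theorems.ByReductionTypeAtTwoMultTowerSplitZeroBit
import HarnessLib

/-!
# Route `ByReductionTypeAtTwo`, crux `MultUpperHalfAtTwo` (item stmt-BirchSwinnertonDyer-19922): the ZERO-BIT TOWER-gap doors at a
# SPLIT multiplicative `2` with Tate unit `≡ ±3 (mod 8)` — `C₂ = 1` from the kernel theorem
# `MultTowerSP1.twoTorsion_localTowerKerPrimary_le_one_splitTwo_of_tateUnit` (no PRINT binder at `2`, no Tate-period certificate)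

HONEST FRAMING (cell `bsd-2adic`, run/shared/lean/pub/bsd-2adic/, seat `bsd-2adic-tower-1` GEN 10, HUMAN RULINGS D-0036 / D-0054 /
D-0074): research route; THEOREMS ONLY; nothing is booked; BSD is not proved by any of this. The cell's split TOWER doors
(`MultTowerCert.towerGapAtTwo_of_layerSelmer_cert_splitTwo`, `MultTowerTorsion.…_splitTwo_of_torsion/_of_goodPrime`, seat mult-2) charge the
place `v ∋ 2` with `C₂ = 2^{k_q}` and display, on the `k_q = 0` rows, the PRINT binder `hSP`
(`Greenberg1999.sec3_natCard_localTowerKerPrimary_splitMultiplicative_rat`), a Tate datum `Dq : TateParameterData W 2` with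
`hlog : log₂ q_E ≠ 0` (`hBDGP`) and the valuation hypothesis `hkq : ord₂(log₂ q_E) ≤ 2`. Since `ord₂(log₂ q_E) = 2` iff the Tate
unit is `≡ ±3 (mod 8)` iff `(Δ_min/2^k)·c₄ ≡ ±3 (mod 8)` (BRICK 5/6), the kernel theorem
`MultTowerSP1.twoTorsion_localTowerKerPrimary_le_one_splitTwo_of_tateUnit` (`…MultTowerSplitZeroBit.lean`, this seat: `#𝒦_{v,n}[2^∞][2] ≤ 1`
at EVERY layer) replaces all four by the decidable datum `∃ k u c, Δ_min = 2^k u ∧ c₄ = c ∧ u·c ≡ 3, 5 (mod 8)` — the same datum the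
non-split one-bit rows display (`…MultTowerNS2OneBitDefs.lean`). WHAT IS STILL DISPLAYED, NOT PROVED: PRINT {`h33g`, `hM`, `hA`};
the layer counts `hlow`/`hup`, the torsion data and the arithmetic `harith` (certificate legs), now with `C₂ = 1`:
`2^d · ∏_{ℓ ∈ P} C_ℓ^{2^{min(j', e_ℓ)}} < 2^{2^{j'} − 2^j + a}`. References: R. Greenberg, LNM 1716 (1999) §3 pp. 85–93.
-/

set_option autoImplicit false
-- the Theorems namespace of this sub repeats the summit name by design (D-0017 nested layout: Summit.<S>.<Sub>)
set_option linter.dupNamespace false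

noncomputable section

open scoped Classical

open NumberField IsDedekindDomain WeierstrassCurve Literature.NumberTheory.EllipticCurves
  Literature.NumberTheory.EllipticCurves.Greenberg1999
  Summit.BirchSwinnertonDyer.Rank1Residual.X5 Summit.BirchSwinnertonDyer.Rank1Residual.X5.O1
  Summit.BirchSwinnertonDyer.Rank1Residual

namespace Summit.BirchSwinnertonDyer.BirchSwinnertonDyer.Theorems.MultTowerCert

variable (W : WeierstrassCurve ℚ) [W.IsElliptic] [W.IsGloballyMinimal]

/-- **`h2` at a SPLIT multiplicative `2` with Tate unit `≡ ±3 (mod 8)`, ZERO bits: `C₂ = 1`** at every layer `n` — the kernel theorem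
`MultTowerSP1.twoTorsion_localTowerKerPrimary_le_one_splitTwo_of_tateUnit` in the `h2`-shape of `towerGapAtTwo_of_layerSelmer_cert_atTwo`.
[cite: GreenbergLNM1716, §3, between Prop. 3.6 and Prop. 3.7 (PDF pp. 91–93)] -/
theorem atTwo_le_one_of_split_zeroBit_kernel (hsplit : W.HasSplitMultiplicativeReductionAtPrime 2)
    (htu : ∃ (k : ℕ) (u c : ℤ), W.minimalDiscriminantInt = 2 ^ k * u ∧ W.c₄ = (c : ℚ) ∧ (u * c % 8 = 3 ∨ u * c % 8 = 5))
    (n : ℕ) :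
    ∀ κ : ZpExtension ℚ 2, κ.IsCyclotomic → ∀ v : HeightOneSpectrum (𝓞 ℚ), ((2 : ℕ) : 𝓞 ℚ) ∈ v.asIdeal →
      Finite {x : W.localTowerKerPrimary κ (v.adicCompletion ℚ) n // 2 • x = 0} ∧
        Nat.card {x : W.localTowerKerPrimary κ (v.adicCompletion ℚ) n // 2 • x = 0} ≤ 1 :=
  fun _ hκ v hv ↦ MultTowerSP1.twoTorsion_localTowerKerPrimary_le_one_splitTwo_of_tateUnit W hsplit htu hκ v hv n

/-- **The ZERO-BIT GAP certificate at a SPLIT multiplicative `2` with Tate unit `≡ ±3 (mod 8)`** (odd torsion order): PRINT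
{`h33g`, `hM`, `hA`} + the decidable Tate-unit datum + layer counts at `j ≤ j'` with the arithmetic
`2^d · ∏_{ℓ ∈ P} C_ℓ^{2^{min(j', e_ℓ)}} < 2^{2^{j'} − 2^j + a}` ⟹ `O1.TowerGapAtTwo W` (= `towerGapAtTwo_of_layerSelmer_cert_atTwo` with `C₂ = 1`
from `atTwo_le_one_of_split_zeroBit_kernel`; replaces `towerGapAtTwo_of_layerSelmer_cert_splitTwo` with `hSP, Dq, hlog, hkq (k_q = 0)`).
[cite: GreenbergLNM1716, §3 Lemmas 3.3–3.5 (PDF pp. 86–90) and pp. 90–93] [cite: SilvermanAEC2009, VII.1 Prop. 1.3, VII.5.1] -/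
theorem towerGapAtTwo_of_layerSelmer_cert_splitTwo_zeroBit_kernel
    (h33g : lemma33_localTowerKerPrimary_eq_bot_of_good.{0})
    (hM : lemma33_localTowerKerPrimary_cyclic_of_multiplicative.{0})
    (hA : lemma33_natCard_localTowerKerPrimary_le_four_of_additive.{0})
    (hsplit : W.HasSplitMultiplicativeReductionAtPrime 2)
    (htu : ∃ (k : ℕ) (u c : ℤ), W.minimalDiscriminantInt = 2 ^ k * u ∧ W.c₄ = (c : ℚ) ∧ (u * c % 8 = 3 ∨ u * c % 8 = 5))
    (htors : ¬ 2 ∣ W.torsionOrder) {j j' a d : ℕ} (hjj' : j ≤ j')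
    (P : Finset ℕ) (hP : ∀ ℓ ∈ P, ℓ.Prime ∧ ℓ ≠ 2)
    (hΔ : ∀ ℓ : ℕ, ℓ.Prime → ℓ ≠ 2 → (ℓ : ℤ) ∣ W.minimalDiscriminantInt → ℓ ∈ P)
    (C e k : ℕ → ℕ) (he : ∀ ℓ ∈ P, ¬ 2 ^ (e ℓ + 4) ∣ ℓ ^ 2 - 1)
    (hC : ∀ (ℓ : ℕ) [Fact ℓ.Prime], ℓ ∈ P →
      4 ≤ C ℓ ∨ (W.HasMultiplicativeReductionAtPrime ℓ ∧ 2 ≤ C ℓ) ∨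
        (W.HasMultiplicativeReductionAtPrime ℓ ∧ (ℓ : ℤ) ^ k ℓ ∣ W.minimalDiscriminantInt ∧
          ¬ (ℓ : ℤ) ^ (k ℓ + 1) ∣ W.minimalDiscriminantInt ∧ ¬ 2 ∣ k ℓ ∧ 1 ≤ C ℓ) ∨
        (¬ (ℓ : ℤ) ∣ W.minimalDiscriminantInt ∧ 1 ≤ C ℓ))
    (hlow : ∀ κ : ZpExtension ℚ 2, κ.IsCyclotomic →
      2 ^ a ≤ Nat.card {z : W.selmerLayer κ j // 2 • z = 0})
    (hup : ∀ κ : ZpExtension ℚ 2, κ.IsCyclotomic →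
      Nat.card {z : W.selmerLayer κ j' // 2 • z = 0} ≤ 2 ^ d)
    (harith : 2 ^ d * ∏ ℓ ∈ P, C ℓ ^ 2 ^ min j' (e ℓ) < 2 ^ (2 ^ j' - 2 ^ j + a)) :
    TowerGapAtTwo W :=
  towerGapAtTwo_of_layerSelmer_cert_atTwo W h33g hM hA htors hjj' 1 (atTwo_le_one_of_split_zeroBit_kernel W hsplit htu j')
    P hP hΔ C e k he hC hlow hup (by rw [mul_one]; exact harith)

end Summit.BirchSwinnertonDyer.BirchSwinnertonDyer.Theorems.MultTowerCert

namespace Summit.BirchSwinnertonDyer.BirchSwinnertonDyer.Theorems.MultTowerTorsion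

variable (W : WeierstrassCurve ℚ) [W.IsElliptic] [W.IsGloballyMinimal]

/-- **The ZERO-BIT GAP certificate at a SPLIT multiplicative `2` with Tate unit `≡ ±3 (mod 8)`, rational `2`-torsion allowed** (any
lower layer `j`): `towerGapAtTwo_of_layerSelmer_cert_atTwo_of_torsion` with `C₂ = 1` from `MultTowerCert.atTwo_le_one_of_split_zeroBit_kernel`;
arithmetic `2^{d+t} · ∏_{ℓ∈P} C_ℓ^{2^{min(j', e_ℓ)}} < 2^{2^{j'} − 2^j + a}`.
[cite: GreenbergLNM1716, §3 pp. 85–94 (Lemmas 3.3–3.5; between Prop. 3.6 and 3.7, PDF pp. 91–93)]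
[cite: SilvermanAEC2009, VII.1 Prop. 1.3, VII.5.1] -/
theorem towerGapAtTwo_of_layerSelmer_cert_splitTwo_zeroBit_of_torsion_kernel
    (h33g : lemma33_localTowerKerPrimary_eq_bot_of_good.{0})
    (hM : lemma33_localTowerKerPrimary_cyclic_of_multiplicative.{0})
    (hA : lemma33_natCard_localTowerKerPrimary_le_four_of_additive.{0})
    (hsplit : W.HasSplitMultiplicativeReductionAtPrime 2)
    (htu : ∃ (k : ℕ) (u c : ℤ), W.minimalDiscriminantInt = 2 ^ k * u ∧ W.c₄ = (c : ℚ) ∧ (u * c % 8 = 3 ∨ u * c % 8 = 5))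
    (hB : ∀ κ : ZpExtension ℚ 2, κ.IsCyclotomic →
      Finite (FixedPoints.addSubgroup κ.kerSubgroup (geomPrimaryTorsion W 2)))
    {j j' a d t : ℕ} (hjj' : j ≤ j')
    (htor : ∀ κ : ZpExtension ℚ 2, κ.IsCyclotomic →
      Nat.card {m : geomPrimaryTorsion W 2 | ∀ σ ∈ κ.layerSubgroup j, σ • m = m} ≤ 2 ^ t)
    (P : Finset ℕ) (hP : ∀ ℓ ∈ P, ℓ.Prime ∧ ℓ ≠ 2)
    (hΔ : ∀ ℓ : ℕ, ℓ.Prime → ℓ ≠ 2 → (ℓ : ℤ) ∣ W.minimalDiscriminantInt → ℓ ∈ P)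
    (C e k : ℕ → ℕ) (he : ∀ ℓ ∈ P, ¬ 2 ^ (e ℓ + 4) ∣ ℓ ^ 2 - 1)
    (hC : ∀ (ℓ : ℕ) [Fact ℓ.Prime], ℓ ∈ P →
      4 ≤ C ℓ ∨ (W.HasMultiplicativeReductionAtPrime ℓ ∧ 2 ≤ C ℓ) ∨
        (W.HasMultiplicativeReductionAtPrime ℓ ∧ (ℓ : ℤ) ^ k ℓ ∣ W.minimalDiscriminantInt ∧
          ¬ (ℓ : ℤ) ^ (k ℓ + 1) ∣ W.minimalDiscriminantInt ∧ ¬ 2 ∣ k ℓ ∧ 1 ≤ C ℓ) ∨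
        (¬ (ℓ : ℤ) ∣ W.minimalDiscriminantInt ∧ 1 ≤ C ℓ))
    (hlow : ∀ κ : ZpExtension ℚ 2, κ.IsCyclotomic →
      2 ^ a ≤ Nat.card {z : W.selmerLayer κ j // 2 • z = 0})
    (hup : ∀ κ : ZpExtension ℚ 2, κ.IsCyclotomic →
      Nat.card {z : W.selmerLayer κ j' // 2 • z = 0} ≤ 2 ^ d)
    (harith : 2 ^ (d + t) * ∏ ℓ ∈ P, C ℓ ^ 2 ^ min j' (e ℓ) < 2 ^ (2 ^ j' - 2 ^ j + a)) :
    TowerGapAtTwo W :=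
  towerGapAtTwo_of_layerSelmer_cert_atTwo_of_torsion W h33g hM hA hB hjj' htor 1
    (MultTowerCert.atTwo_le_one_of_split_zeroBit_kernel W hsplit htu j') P hP hΔ C e k he hC hlow hup
    (by rw [mul_one]; exact harith)

/-- **The ZERO-BIT GAP certificate at a SPLIT multiplicative `2` with Tate unit `≡ ±3 (mod 8)`, lower layer `ℚ`, every remaining
datum PRINT or decidable**: `hB` from the tree theorem `Greenberg1999.finite_torsion_cyclotomicZpExtension_holds` (pass it for `hBtors`), the
torsion count from a good prime `ℓ₀ ≥ 3` with `#Ẽ(𝔽_{ℓ₀}) = n`, `¬ 2^{t+1} ∣ n`; arithmetic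
`2^{d+t} · ∏_{ℓ∈P} C_ℓ^{2^{min(j', e_ℓ)}} < 2^{2^{j'} − 1 + a}`.
[cite: GreenbergLNM1716, §1 p. 62, §3 pp. 85–94, §4 Lemma 4.3] [cite: SilvermanAEC2009, VII.3 Prop. 3.1(b), VII.5.1]
[cite: Ribet1981KatzLangAppendix, Theorem (p. 315)] -/
theorem towerGapAtTwo_of_layerSelmer_cert_splitTwo_zeroBit_of_goodPrime_kernel
    (h33g : lemma33_localTowerKerPrimary_eq_bot_of_good.{0})
    (hM : lemma33_localTowerKerPrimary_cyclic_of_multiplicative.{0})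
    (hA : lemma33_natCard_localTowerKerPrimary_le_four_of_additive.{0})
    (hsplit : W.HasSplitMultiplicativeReductionAtPrime 2)
    (htu : ∃ (k : ℕ) (u c : ℤ), W.minimalDiscriminantInt = 2 ^ k * u ∧ W.c₄ = (c : ℚ) ∧ (u * c % 8 = 3 ∨ u * c % 8 = 5))
    (hBtors : finite_torsion_cyclotomicZpExtension)
    (ℓ₀ : ℕ) [Fact ℓ₀.Prime] (h3 : 3 ≤ ℓ₀) (hgood : W.HasGoodReductionAtPrime ℓ₀) {t n : ℕ}
    (hn : W.reductionPointCount ℓ₀ = n) (hndvd : ¬ 2 ^ (t + 1) ∣ n) {j' a d : ℕ}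
    (P : Finset ℕ) (hP : ∀ ℓ ∈ P, ℓ.Prime ∧ ℓ ≠ 2)
    (hΔ : ∀ ℓ : ℕ, ℓ.Prime → ℓ ≠ 2 → (ℓ : ℤ) ∣ W.minimalDiscriminantInt → ℓ ∈ P)
    (C e k : ℕ → ℕ) (he : ∀ ℓ ∈ P, ¬ 2 ^ (e ℓ + 4) ∣ ℓ ^ 2 - 1)
    (hC : ∀ (ℓ : ℕ) [Fact ℓ.Prime], ℓ ∈ P →
      4 ≤ C ℓ ∨ (W.HasMultiplicativeReductionAtPrime ℓ ∧ 2 ≤ C ℓ) ∨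
        (W.HasMultiplicativeReductionAtPrime ℓ ∧ (ℓ : ℤ) ^ k ℓ ∣ W.minimalDiscriminantInt ∧
          ¬ (ℓ : ℤ) ^ (k ℓ + 1) ∣ W.minimalDiscriminantInt ∧ ¬ 2 ∣ k ℓ ∧ 1 ≤ C ℓ) ∨
        (¬ (ℓ : ℤ) ∣ W.minimalDiscriminantInt ∧ 1 ≤ C ℓ))
    (hlow : ∀ κ : ZpExtension ℚ 2, κ.IsCyclotomic →
      2 ^ a ≤ Nat.card {z : W.selmerLayer κ 0 // 2 • z = 0})
    (hup : ∀ κ : ZpExtension ℚ 2, κ.IsCyclotomic →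
      Nat.card {z : W.selmerLayer κ j' // 2 • z = 0} ≤ 2 ^ d)
    (harith : 2 ^ (d + t) * ∏ ℓ ∈ P, C ℓ ^ 2 ^ min j' (e ℓ) < 2 ^ (2 ^ j' - 1 + a)) :
    TowerGapAtTwo W :=
  towerGapAtTwo_of_layerSelmer_cert_splitTwo_zeroBit_of_torsion_kernel W h33g hM hA hsplit htu (fun κ hκ ↦ hBtors W 2 κ hκ)
    (Nat.zero_le j') (fun κ _ ↦ natCard_fixedBy_layerSubgroup_zero_le_of_goodPrime W ℓ₀ h3 hgood hn hndvd κ)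
    P hP hΔ C e k he hC hlow hup (by rw [pow_zero]; exact harith)

end Summit.BirchSwinnertonDyer.BirchSwinnertonDyer.Theorems.MultTowerTorsion

end
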